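import Mathlib

/-!
# HodgeLocusCensusGKHesseTauAnchors — the identity `τ_can = μ³ − 1` and the depth-law arithmetic (DERIVATION-GK-A §5j / PREREG-P37 §7, engine A, gen 37)

certified instances and evidence bearing on the general Hodge conjecture; no claim.

On the Hesse pencil `H_μ : X³ + Y³ + Z³ = 3μXYZ` (origin `[1:-1:0]`) the `X₀(3)`-Hauptmodul
`t = (η(z)/η(3z))¹²` of the pair `(H_μ, C_Z)`, `C_Z` = the three flexes on `Z = 0`, equals
`27(μ³ - 1)` (P37-T).  The modular-curve part of that statement (cusp widths, `μ ↦ ωμ` invariance)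
is not formalised; this file kernel-checks the ALGEBRA it rests on and the arithmetic of the depth
law P37-D:

* `modelM_c4` — `c₄(M_μ) = 16(a₂² - 3a₄) = μ(μ³ + 8)` for the monic model `M_μ` of §5i;
* `hesse_j_via_t` — with `t = 27(μ³-1)`: `c₄³ · 27 · t³ = (t+27)(t+243)³ · (μ³-1)³`, i.e.
  `j(H_μ) = c₄³/Δ = 27μ³(μ³+8)³/(μ³-1)³ = (t+27)(t+243)³/t³` (using `Δ(M_μ) = (μ³-1)³/27`,
  theorem `modelM_disc` of the companion file `HodgeLocusCensusGKHesseAnchors`);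
* `deuring_dictionary` — `27/(α³-27) + 1 = α³/(α³-27)` (`τ = μ³ - 1` against Deuring's
  `t(E_α, ⟨(0,0)⟩) = 729/(α³-27)` gives `μ³ = α³/(α³-27)`);
* `modular_eq_const` — the product of the four roots: `27 · 243³ = 3¹⁸`, so `Σ v₃(tᵢ) = 18`;
* `depth_arith` — `3 + 3(2a-1) = 6a` and `18 - 6a = 3(6-2a)` (P37-D: `v(t_can) = 6a`, the other
  three roots `6 - 2a` each), and `6a - 3 = 0 ↔ a = 1/2` (the unit law P36-U re-derived).

Helper file, computational (`--supports stmt-HodgeConjecture-16267 --as helper`).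
-/

set_option linter.dupNamespace false

namespace Summit.HodgeConjecture.HodgeConjecture.HodgeLocus.Census.GKHesseTauAnchors

section ring_identities
variable {R : Type*} [CommRing R]

/-- `c₄ = 16(a₂² − 3a₄)` for `a₂ = −3μ²/4`, `a₄ = μ(μ³−1)/6`, cleared of denominators:
`16·((3μ²)² ·9 − 3·16·6·μ(μ³−1)·… )` — stated as `(4·a₂)² − 48·a₄ = μ(μ³+8)` with `4a₂ = −3μ²`,
`6a₄ = μ(μ³−1)`: `(−3μ²)² − 8·(μ(μ³−1)) = μ(μ³+8)`. -/
theorem modelM_c4 (μ : R) : (-3 * μ ^ 2) ^ 2 - 8 * (μ * (μ ^ 3 - 1)) = μ * (μ ^ 3 + 8) := by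
  ring

/-- P37-T algebra: with `t = 27(μ³ − 1)` and `c₄ = μ(μ³+8)`,
`27 · c₄³ · t³ = (t + 27)(t + 243)³ (μ³ − 1)³·27`, equivalently `j = 27 c₄³/(μ³−1)³ = (t+27)(t+243)³/t³`. -/
theorem hesse_j_via_t (μ : R) :
    27 * (μ * (μ ^ 3 + 8)) ^ 3 * (27 * (μ ^ 3 - 1)) ^ 3
      = (27 * (μ ^ 3 - 1) + 27) * (27 * (μ ^ 3 - 1) + 243) ^ 3 * (μ ^ 3 - 1) ^ 3 := by
  ring

/-- The same with the discriminant made explicit: `Δ = (μ³−1)³/27` means `27Δ = (μ³−1)³`; then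
`c₄³ · t³ = Δ · (t+27)(t+243)³` reads, after multiplying by 27: -/
theorem hesse_j_via_t' (μ Δ27 : R) (hΔ : Δ27 = (μ ^ 3 - 1) ^ 3) :
    27 * ((μ * (μ ^ 3 + 8)) ^ 3 * (27 * (μ ^ 3 - 1)) ^ 3)
      = Δ27 * ((27 * (μ ^ 3 - 1) + 27) * (27 * (μ ^ 3 - 1) + 243) ^ 3) := by
  subst hΔ; ring

end ring_identities

section field_identities
variable {K : Type*} [Field K]

/-- Deuring dictionary: `τ = 27/(α³ − 27)` and `τ = μ³ − 1` force `μ³ = α³/(α³ − 27)`. -/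
theorem deuring_dictionary (α : K) (h : α ^ 3 - 27 ≠ 0) :
    27 / (α ^ 3 - 27) + 1 = α ^ 3 / (α ^ 3 - 27) := by
  field_simp
  ring

/-- Depth-law arithmetic (P37-D): `v(t_can) = 3 + 3d` with `d = 2a − 1` is `6a`; the remaining
valuation `18 − 6a` splits as three equal parts `6 − 2a`; and `v(τ_can) = 6a − 3` vanishes iff
`a = 1/2` (unit law). -/
theorem depth_arith (a : ℚ) :
    3 + 3 * (2 * a - 1) = 6 * a ∧ 18 - 6 * a = 3 * (6 - 2 * a) ∧ (6 * a - 3 = 0 ↔ a = 1 / 2) := by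
  refine ⟨by ring, by ring, ?_⟩
  constructor <;> intro h <;> linarith

/-- The registered multisets of P37-D for the depths met in the census:
`a ↦ (6a, 6 − 2a)` at `a = 1/2, 1/6, 1/4, 1/3, 5/8`. -/
theorem depth_table :
    (6 * (1/2 : ℚ), 6 - 2 * (1/2 : ℚ)) = (3, 5) ∧ (6 * (1/6 : ℚ), 6 - 2 * (1/6 : ℚ)) = (1, 17/3) ∧
    (6 * (1/4 : ℚ), 6 - 2 * (1/4 : ℚ)) = (3/2, 11/2) ∧ (6 * (1/3 : ℚ), 6 - 2 * (1/3 : ℚ)) = (2, 16/3) ∧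
    (6 * (5/8 : ℚ), 6 - 2 * (5/8 : ℚ)) = (15/4, 19/4) := by
  norm_num

end field_identities

/-- Product of the four roots of `(t+27)(t+243)³ − j t³`: the constant term `27 · 243³ = 3¹⁸`. -/
theorem modular_eq_const : (27 : ℕ) * 243 ^ 3 = 3 ^ 18 := by decide

end Summit.HodgeConjecture.HodgeConjecture.HodgeLocus.Census.GKHesseTauAnchors
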